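import Mathlib
import Summits.KontsevichZagierPeriods.Zeta5Search.Families.IntegrabilityCriterion
import HarnessLib

/-!
# ζ(5) search — Families: the basic cellular integrand is at most `ω_σ` — `f_σ ≤ 1` and `I_σ(N)` is non-increasing

HONEST FRAMING: systematic search; no irrationality claim unless certified.  This file contains NO statement about the
arithmetic of a zeta value; it is a STRUCTURAL fact about every cellular family (seat P2, Families layer).

For a bijective seating `σ` of `n = ℓ + 3` points, Brown's function `f_σ = ∏_i (z_i − z_{i+1}) / ∏_i (z_{σ_i} − z_{σ_{i+1}})`
(finite factors; [Brown2016, §1.5 (1.3)]) satisfies **`0 < f_σ ≤ 1` on the open simplex** (`fSigma_le_one`).  Proof: a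
HALL MATCHING — the `ℓ+1` finite `σδ⁰`-edges can be matched injectively (hence bijectively) to the `ℓ+1` gaps so that
each edge receives a gap inside its own span (`exists_gap_matching`), because for every block `B` of finite points the
Hamiltonian cycle `σ` has at most `|B| − 1` edges inside `B` (`card_edges_inside_lt`) and an edge span is an interval
(`EdgePowers.span_subset_split`); then `f_σ = ∏_edges gap(m e)/len(e) ≤ 1`.  Consequences: the basic integrands
decrease with the exponent (`basic_succ_le`), and **the basic cellular integrals `I_σ(N) = ∫ f_σ^N ω_σ`, `N ∈ ℕ`, form a
NON-INCREASING sequence** (`integral_basic_succ_le`, `integral_basic_antitone`; for non-convergent `σ` every term is the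
junk value `0` by `integrableOn_basic_iff_convergent`).  Standard axioms only.
-/

noncomputable section

open MeasureTheory Set Finset

namespace Summit.KontsevichZagierPeriods.Zeta5Search.Families.Cellular

variable {ℓ : ℕ} (σ : Fin (ℓ + 3) → Fin (ℓ + 3))

/-! ### The cycle lemma: at most `|B| − 1` edges of `σδ⁰` inside a proper block `B` -/

open Fin.NatCast Fin.CommRing in
/-- For a bijective seating `σ` and a nonempty proper vertex set `B`, the number of positions `i` with both `σ_i` and
`σ_{i+1}` in `B` is less than `|B|` (a Hamiltonian cycle restricted to `B` is a union of paths). -/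
theorem card_edges_inside_lt (hσ : Function.Bijective σ) (B : Finset (Fin (ℓ + 3))) (hB : B.Nonempty)
    (hBne : B ≠ Finset.univ) : (Finset.univ.filter fun i => σ i ∈ B ∧ σ (i + 1) ∈ B).card < B.card := by
  classical
  set A' := univ.filter fun i : Fin (ℓ + 3) => σ i ∈ B with hA'
  have hcard : A'.card = B.card := by
    have : A' = B.map (Equiv.ofBijective σ hσ).symm.toEmbedding := by
      ext i
      simp only [hA', Finset.mem_filter, Finset.mem_univ, true_and, Finset.mem_map, Equiv.toEmbedding_apply]
      constructor
      · intro h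
        exact ⟨σ i, h, by rw [Equiv.symm_apply_eq]; rfl⟩
      · rintro ⟨v, hv, rfl⟩
        have : σ ((Equiv.ofBijective σ hσ).symm v) = v := (Equiv.ofBijective σ hσ).apply_symm_apply v
        rw [this]; exact hv
    rw [this, Finset.card_map]
  rw [← hcard]
  refine Finset.card_lt_card ⟨fun i hi => ?_, fun hsub => ?_⟩
  · simp only [hA', Finset.mem_filter, Finset.mem_univ, true_and] at hi ⊢
    exact hi.1
  · -- closure under the successor forces `B = univ`
    have hstep : ∀ i, σ i ∈ B → σ (i + 1) ∈ B := fun i hi => by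
      have : i ∈ A' := by simp [hA', hi]
      have := hsub this
      simp only [Finset.mem_filter, Finset.mem_univ, true_and] at this
      exact this.2
    obtain ⟨v, hv⟩ := hB
    obtain ⟨i0, rfl⟩ := hσ.2 v
    have hall : ∀ k : ℕ, σ (i0 + (k : Fin (ℓ + 3))) ∈ B := by
      intro k
      induction k with
      | zero => simpa using hv
      | succ k ih =>
        have := hstep _ ih
        rwa [add_assoc, ← Nat.cast_succ] at this
    apply hBne
    refine Finset.eq_univ_of_forall fun w => ?_
    obtain ⟨i, rfl⟩ := hσ.2 w
    have := hall ((i - i0).val)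
    rwa [Fin.cast_val_eq_self, add_sub_cancel] at this

/-! ### Hall matching of the finite `σδ⁰`-edges to the gaps -/

variable (hσi : Function.Injective σ)

/-- The number of finite `σδ⁰`-edges with span inside a gap set `L` is at most `|L|`. -/
theorem card_filter_span_subset_le (hσ : Function.Bijective σ) :
    ∀ n : ℕ, ∀ L : Finset (Fin (ℓ + 1)), L.card = n →
      (univ.filter fun i : SEdge σ => (cellEdges σ hσ.1).span (Sum.inr i) ⊆ L).card ≤ L.card := by
  classical
  intro n
  induction n using Nat.strong_induction_on with
  | _ n ih =>
    intro L hLn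
    rcases L.eq_empty_or_nonempty with rfl | hne
    · rw [Finset.card_empty, Nat.le_zero, Finset.card_eq_zero, Finset.filter_eq_empty_iff]
      intro i _ h
      obtain ⟨w, hw⟩ := (cellEdges σ hσ.1).span_nonempty (Sum.inr i)
      exact Finset.notMem_empty w (h hw)
    set p : ℕ := (L.min' hne).val with hp
    set q : ℕ := (L.max' hne).val + 1 with hq
    have hsub : L ⊆ gapRun ℓ p q := by
      intro w hw
      rw [mem_gapRun]
      exact ⟨Fin.le_def.1 (L.min'_le w hw), Nat.lt_succ_of_le (Fin.le_def.1 (L.le_max' w hw))⟩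
    by_cases hrun : gapRun ℓ p q ⊆ L
    · -- `L` is a run: use the cycle lemma on the block of points `p,…,q`
      have hL : L = gapRun ℓ p q := Finset.Subset.antisymm hsub hrun
      have hpq : p < q := by have := Fin.le_def.1 (L.min'_le _ (L.max'_mem hne)); omega
      have hq' : q ≤ ℓ + 1 := by have := (L.max' hne).isLt; omega
      have hcardL : L.card = q - p := by rw [hL, card_gapRun p q hq']
      -- compare with the positions having both endpoints in `vblock p q`
      have hle : (univ.filter fun i : SEdge σ => (cellEdges σ hσ.1).span (Sum.inr i) ⊆ L).card ≤
          (univ.filter fun i : Fin (ℓ + 3) => σ i ∈ vblock ℓ p q ∧ σ (i + 1) ∈ vblock ℓ p q).card := by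
        refine Finset.card_le_card_of_injOn (fun i => i.1) (fun i hi => ?_) (fun i _ j _ h => Subtype.ext h)
        simp only [Finset.coe_filter, Finset.mem_univ, true_and, Set.mem_setOf_eq] at hi ⊢
        rw [hL, (cellEdges σ hσ.1).span_subset_gapRun_iff] at hi
        simp only [cellEdges, Sum.elim_inr] at hi
        rw [mem_vblock, mem_vblock]
        omega
      refine hle.trans ?_
      have hB : (vblock ℓ p q).Nonempty := ⟨⟨p, by omega⟩, by rw [mem_vblock]; simp only; omega⟩
      have hBne : vblock ℓ p q ≠ Finset.univ := by
        intro h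
        have : (Fin.last (ℓ + 2)) ∈ vblock ℓ p q := h ▸ Finset.mem_univ _
        rw [mem_vblock, Fin.val_last] at this
        omega
      have := card_edges_inside_lt σ hσ (vblock ℓ p q) hB hBne
      rw [card_vblock p q hq'] at this
      omega
    · -- split at a missing gap
      obtain ⟨w0, hw0r, hw0L⟩ := Finset.not_subset.1 hrun
      set L1 := L.filter (fun w => w.val < w0.val) with hL1
      set L2 := L.filter (fun w => ¬ w.val < w0.val) with hL2
      have hmin1 : L.min' hne ∈ L1 := by
        rw [hL1, Finset.mem_filter]
        refine ⟨L.min'_mem hne, ?_⟩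
        have h1 : p ≤ w0.val := ((mem_gapRun p q w0).1 hw0r).1
        have h2 : (L.min' hne).val ≠ w0.val := fun h => hw0L ((Fin.ext h) ▸ L.min'_mem hne)
        omega
      have hmax2 : L.max' hne ∈ L2 := by
        rw [hL2, Finset.mem_filter]
        refine ⟨L.max'_mem hne, ?_⟩
        have h1 : w0.val < q := ((mem_gapRun p q w0).1 hw0r).2
        omega
      have hne1 : L1.Nonempty := ⟨_, hmin1⟩
      have hne2 : L2.Nonempty := ⟨_, hmax2⟩
      have hdisj : Disjoint L1 L2 := by
        rw [hL1, hL2]; exact Finset.disjoint_filter_filter_not L L fun w => w.val < w0.val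
      have hunion : L1 ∪ L2 = L := by rw [hL1, hL2]; exact Finset.filter_union_filter_not_eq _ L
      have hcardsum : L1.card + L2.card = L.card := by rw [← Finset.card_union_of_disjoint hdisj, hunion]
      have h1 := ih L1.card (by have := hne2.card_pos; omega) L1 rfl
      have h2 := ih L2.card (by have := hne1.card_pos; omega) L2 rfl
      have hfilt : (univ.filter fun i : SEdge σ => (cellEdges σ hσ.1).span (Sum.inr i) ⊆ L) ⊆
          (univ.filter fun i : SEdge σ => (cellEdges σ hσ.1).span (Sum.inr i) ⊆ L1) ∪
            (univ.filter fun i : SEdge σ => (cellEdges σ hσ.1).span (Sum.inr i) ⊆ L2) := by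
        intro i hi
        simp only [Finset.mem_filter, Finset.mem_univ, true_and, Finset.mem_union] at hi ⊢
        exact ((cellEdges σ hσ.1).span_subset_split L w0 hw0L (Sum.inr i)).1 hi
      calc _ ≤ _ := Finset.card_le_card hfilt
        _ ≤ _ := Finset.card_union_le _ _
        _ ≤ L.card := by rw [← hcardsum]; exact Nat.add_le_add h1 h2

/-- **Hall matching**: an injective assignment of a gap INSIDE its span to every finite `σδ⁰`-edge. -/
theorem exists_gap_matching (hσ : Function.Bijective σ) :
    ∃ m : SEdge σ → Fin (ℓ + 1), Function.Injective m ∧ ∀ i, m i ∈ (cellEdges σ hσ.1).span (Sum.inr i) := by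
  classical
  refine (Finset.all_card_le_biUnion_card_iff_exists_injective (ι := SEdge σ) (α := Fin (ℓ + 1))
    (fun i : SEdge σ => (cellEdges σ hσ.1).span (Sum.inr i))).1 fun s => ?_
  refine le_trans (Finset.card_le_card fun i hi => ?_)
    (card_filter_span_subset_le σ hσ _ (s.biUnion fun i : SEdge σ => (cellEdges σ hσ.1).span (Sum.inr i)) rfl)
  simp only [Finset.mem_filter, Finset.mem_univ, true_and]
  exact Finset.subset_biUnion_of_mem (fun i : SEdge σ => (cellEdges σ hσ.1).span (Sum.inr i)) hi

/-! ### `f_σ ≤ 1` -/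

/-- Brown's function `f_σ` in simplicial coordinates: `∏_i (z_i − z_{i+1}) / ∏_i (z_{σ_i} − z_{σ_{i+1}})` (finite
factors), so that the basic integrand is `f_σ^N / ∏_i (z_{σ_i} − z_{σ_{i+1}})` (`basic_eq`). [Brown2016, §1.5 (1.3)] -/
def fSigma (t : Fin ℓ → ℝ) : ℝ := (∏ i : Fin (ℓ + 3), ef t i (i + 1)) / formDen σ t

/-- The numerator of `f_σ` is the product of all `ℓ+1` gaps. -/
theorem prod_ef_succ_eq_prod_gapN (t : Fin ℓ → ℝ) :
    ∏ i : Fin (ℓ + 3), ef t i (i + 1) = ∏ w : Fin (ℓ + 1), gapN t w := by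
  have h := num_eq_prod_subtype (ℓ := ℓ) (fun _ => (1 : ℤ)) t
  simp only [num, zpow_one] at h
  rw [h]
  -- reindex `{i : Fin (ℓ+3) // i.val ≤ ℓ} ≃ Fin (ℓ+1)`
  let e : Fin (ℓ + 1) ≃ DEdge ℓ :=
    { toFun := fun w => ⟨⟨w.val, by omega⟩, by simp only; omega⟩
      invFun := fun i => ⟨i.1.val, by have := i.2; omega⟩
      left_inv := fun w => by ext; rfl
      right_inv := fun i => by ext; rfl }
  rw [← Equiv.prod_comp e]
  rfl

/-- The denominator `∏_i (z_{σ_i} − z_{σ_{i+1}})` is the product of the lengths of the finite `σδ⁰`-edges. -/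
theorem formDen_eq_prod_len (hσ : Function.Bijective σ) {t : Fin ℓ → ℝ} (ht : t ∈ openSimplex ℓ) :
    formDen σ t = ∏ i : SEdge σ, (cellEdges σ hσ.1).len t (Sum.inr i) := by
  have h := den_mul_formDen_eq_prod_subtype σ hσ.1 (fun _ => (0 : ℤ)) ht
  have hden : den σ (fun _ => (0 : ℤ)) t = 1 := by simp [den]
  rw [hden, one_mul] at h
  rw [h]
  refine Finset.prod_congr rfl fun i _ => ?_
  simp [cellEdges, EdgeFamily.len]

/-- **`0 < f_σ ≤ 1` on the open simplex**, for every bijective seating. -/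
theorem fSigma_le_one (hσ : Function.Bijective σ) {t : Fin ℓ → ℝ} (ht : t ∈ openSimplex ℓ) : fSigma σ t ≤ 1 := by
  classical
  obtain ⟨m, hm, hspan⟩ := exists_gap_matching σ hσ
  have hpos := (mem_openSimplex_iff_gapN t).1 ht
  have hden : 0 < formDen σ t := Finset.prod_pos fun i _ => ef_pos ht fun e => succ_ne_self i (hσ.1 e)
  unfold fSigma
  rw [div_le_one hden, prod_ef_succ_eq_prod_gapN, formDen_eq_prod_len σ hσ ht]
  -- the matching is a bijection `SEdge σ ≃ Fin (ℓ+1)` (injective between types of equal cardinality)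
  have hcard : Fintype.card (SEdge σ) = Fintype.card (Fin (ℓ + 1)) := by
    apply le_antisymm (Fintype.card_le_of_injective m hm)
    -- `ℓ + 1 ≤ #SEdge`: the complement has at most the two positions adjacent to `σ⁻¹(∞)`
    obtain ⟨j, hj⟩ := hσ.2 (Fin.last (ℓ + 2))
    have hsub : (univ.filter fun i : Fin (ℓ + 3) => ¬ ((σ i).val ≠ ℓ + 2 ∧ (σ (i + 1)).val ≠ ℓ + 2)) ⊆
        {j, j - 1} := by
      intro i hi
      simp only [Finset.mem_filter, Finset.mem_univ, true_and, not_and_or, not_not] at hi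
      rw [Finset.mem_insert, Finset.mem_singleton]
      rcases hi with h | h
      · left; apply hσ.1; rw [hj]; exact Fin.ext (by rw [h, Fin.val_last])
      · right
        have : i + 1 = j := by apply hσ.1; rw [hj]; exact Fin.ext (by rw [h, Fin.val_last])
        rw [← this, add_sub_cancel_right]
    have h2 : (univ.filter fun i : Fin (ℓ + 3) => ¬ ((σ i).val ≠ ℓ + 2 ∧ (σ (i + 1)).val ≠ ℓ + 2)).card ≤ 2 :=
      (Finset.card_le_card hsub).trans (Finset.card_insert_le _ _)
    have hsum := Finset.card_filter_add_card_filter_not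
      (s := (Finset.univ : Finset (Fin (ℓ + 3)))) (fun i : Fin (ℓ + 3) => (σ i).val ≠ ℓ + 2 ∧ (σ (i + 1)).val ≠ ℓ + 2)
    rw [Finset.card_univ, Fintype.card_fin] at hsum
    rw [Fintype.card_fin, Fintype.card_subtype]
    omega
  let e : SEdge σ ≃ Fin (ℓ + 1) := Equiv.ofBijective m ((Fintype.bijective_iff_injective_and_card m).2 ⟨hm, hcard⟩)
  rw [← Equiv.prod_comp e]
  refine Finset.prod_le_prod (fun i _ => (hpos _).le) fun i _ => ?_
  -- `gap (m i) ≤ len i` since `m i ∈ span i`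
  show gapN t (m i) ≤ (cellEdges σ hσ.1).len t (Sum.inr i)
  rw [(cellEdges σ hσ.1).len_eq_sum_gap]
  exact Finset.single_le_sum (fun w _ => (hpos w).le) (hspan i)

/-- `f_σ` is positive on the open simplex. -/
theorem fSigma_pos (hσi : Function.Injective σ) {t : Fin ℓ → ℝ} (ht : t ∈ openSimplex ℓ) : 0 < fSigma σ t := by
  unfold fSigma
  exact div_pos (Finset.prod_pos fun i _ => ef_pos ht (succ_ne_self i))
    (Finset.prod_pos fun i _ => ef_pos ht fun e => succ_ne_self i (hσi e))

/-! ### Monotonicity in the exponent -/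

/-- On the open simplex the basic integrands decrease with the exponent: `f_σ^{N+1} ω_σ ≤ f_σ^N ω_σ`. -/
theorem basic_succ_le (hσ : Function.Bijective σ) (N : ℤ) {t : Fin ℓ → ℝ} (ht : t ∈ openSimplex ℓ) :
    basic σ (N + 1) t ≤ basic σ N t := by
  have hf := fSigma_pos σ hσ.1 ht
  have hden : 0 < formDen σ t := Finset.prod_pos fun i _ => ef_pos ht fun e => succ_ne_self i (hσ.1 e)
  rw [basic_eq, basic_eq]
  change fSigma σ t ^ (N + 1) / formDen σ t ≤ fSigma σ t ^ N / formDen σ t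
  rw [zpow_add_one₀ hf.ne']
  refine div_le_div_of_nonneg_right ?_ hden.le
  calc fSigma σ t ^ N * fSigma σ t ≤ fSigma σ t ^ N * 1 :=
        mul_le_mul_of_nonneg_left (fSigma_le_one σ hσ ht) (zpow_pos hf N).le
    _ = fSigma σ t ^ N := mul_one _

/-- **The basic cellular integrals are non-increasing in `N ∈ ℕ`**: `I_σ(N+1) ≤ I_σ(N)` for every bijective seating
(both sides are the junk value `0` when `σ` is not convergent). [structural; Brown2016 §1.5 objects] -/
theorem integral_basic_succ_le (hσ : Function.Bijective σ) (N : ℕ) :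
    integral σ (fun _ => ((N : ℤ) + 1)) (fun _ => ((N : ℤ) + 1)) ≤ integral σ (fun _ => (N : ℤ)) (fun _ => (N : ℤ)) := by
  by_cases hc : Convergent σ
  · have h0 : IntegrableOn (basic σ (N : ℤ)) (openSimplex ℓ) :=
      integrableOn_basic_of_convergent σ hσ hc (Int.natCast_nonneg N)
    have h1 : IntegrableOn (basic σ ((N : ℤ) + 1)) (openSimplex ℓ) :=
      integrableOn_basic_of_convergent σ hσ hc (by positivity)
    exact setIntegral_mono_on h1 h0 (measurableSet_openSimplex ℓ) fun t ht => basic_succ_le σ hσ N ht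
  · have h0 : ¬ IntegrableOn (basic σ (N : ℤ)) (openSimplex ℓ) :=
      fun h => hc ((integrableOn_basic_iff_convergent σ hσ (Int.natCast_nonneg N)).1 h)
    have h1 : ¬ IntegrableOn (basic σ ((N : ℤ) + 1)) (openSimplex ℓ) :=
      fun h => hc ((integrableOn_basic_iff_convergent σ hσ (by positivity)).1 h)
    have h0' : ¬ Integrable (integrand σ (fun _ => (N : ℤ)) (fun _ => (N : ℤ))) (volume.restrict (openSimplex ℓ)) := h0
    have h1' : ¬ Integrable (integrand σ (fun _ => (N : ℤ) + 1) (fun _ => (N : ℤ) + 1))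
        (volume.restrict (openSimplex ℓ)) := h1
    unfold integral
    rw [integral_undef h0', integral_undef h1']

/-- The sequence `N ↦ I_σ(N)` is antitone on `ℕ`. -/
theorem integral_basic_antitone (hσ : Function.Bijective σ) :
    Antitone fun N : ℕ => integral σ (fun _ => (N : ℤ)) (fun _ => (N : ℤ)) :=
  antitone_nat_of_succ_le fun N => by
    have := integral_basic_succ_le σ hσ N
    simpa [Nat.cast_succ] using this

end Summit.KontsevichZagierPeriods.Zeta5Search.Families.Cellular
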